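import Mathlib
import HarnessLib
import Literature.NumberTheory.GaloisRepresentations.AdequateSubgroup
import Literature.NumberTheory.GaloisRepresentations.EnormousSubgroup
import Literature.NumberTheory.GaloisRepresentations.AdequacyDegreeP
import Literature.GroupTheory.SpecificGroups.GL2SubgroupOrderDivisibleContainsSL2

/-!
# `H¹(G, 𝔰𝔩₂) = 0` in characteristic `3` when the Sylow `3`-subgroup of `G ≤ GL₂(k)` has order `3`
(a brick towards discharging the named fact `blgg2013_propA21_three`; helper for crux
`CoreAdequacySplit.NoAdequateLayerLifting`, line `birth`, stub `stub_rung_rank2_ell3`)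

Def-free helper file, everything PROVED.  Barnet-Lamb–Gee–Geraghty (Math. Ann. 2013, App. A,
proof of Prop. A.2.1, Points 3 and 4) verify clause (4) of adequacy, `H¹(G, 𝔤𝔩₂) = 0`, for the
`PGL₂(𝔽₃) ≅ S₄` and `A₅` types at `ℓ = 3` by hand.  Both are instances of one mechanism, recorded
here for the tree's `ad⁰ = 𝔰𝔩₂` (clause (iii) of `Subgroup.IsThorneAdequate`):

* `conj_sum_eq_of_mul_self_eq_zero` — for `u = 1 + N`, `N² = 0`, in characteristic `3`:
  `x + u x u⁻¹ + u² x u⁻² = N x N` for every `2 × 2` matrix `x`;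
* `exists_eq_conj_sub_of_mul_self_eq_zero` — if moreover `N ≠ 0`, every trace-zero `x` with
  `N x N = 0` is `u m u⁻¹ − m` for a trace-zero `m` (i.e. `𝔰𝔩₂` is a free `k[⟨u⟩]`-module, so
  `H¹(⟨u⟩, 𝔰𝔩₂) = 0`; proved in the frame `N = (0 1; 0 0)` reached by conjugation);
* `adZeroRep_cocycles₁_le_coboundaries₁_of_card` — **for a finite `G ≤ GL₂(k)`, `char k = 3`,
  with `9 ∤ |G|` and containing an element `u` of order `3`, `H¹(G, ad⁰) = 0`**: a `1`-cocycle
  restricted to `⟨u⟩` is a coboundary by the two previous items (`f(u³) = 0` is the cocycle sum),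
  and restriction to the subgroup `⟨u⟩` of index prime to `3` reflects coboundaries (tree
  `MonomialAdequacy.exists_eq_sub_of_subgroup`, coset averaging).

This covers the cohomological clause for every finite irreducible `G ≤ GL₂(𝔽̄₃)` whose image in
`PGL₂` is `A₄`, `S₄` or `A₅` (Sylow `3`-subgroup of order `3`); the remaining `3`-irregular types
`PSL₂(𝔽_{3^a})`, `PGL₂(𝔽_{3^a})`, `a ≥ 2`, need Darmon–Diamond–Taylor Lemma 2.48 instead.
-/

set_option linter.dupNamespace false

namespace Summit.Langlands.Langlands.Theorems.CoreAdequacy.NoAdequateLayer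

open scoped MatrixGroups Matrix
open Literature.NumberTheory.GaloisRepresentations

variable {k : Type*} [Field k]

/-! ### Matrix identities around a square-zero `N` -/

/-- In characteristic `3`, an element `u` of `GL₂(k)` with `u³ = 1` is `1 + N` with `N² = 0`
(`(u − 1)³ = u³ − 1 = 0` and a nilpotent `2 × 2` matrix squares to zero). [folklore] -/
theorem sub_one_mul_self_eq_zero_of_pow_three [CharP k 3] {u : Matrix (Fin 2) (Fin 2) k} (hu : u ^ 3 = 1) :
    (u - 1) * (u - 1) = 0 := by
  haveI : Fact (Nat.Prime 3) := ⟨Nat.prime_three⟩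
  have h3 : (u - 1) ^ 3 = 0 := by
    rw [sub_pow_char_of_commute (p := 3) (Commute.one_right u), hu, one_pow, sub_self]
  exact Literature.GroupTheory.SpecificGroups.mul_self_eq_zero_of_isNilpotent_fin_two ⟨3, h3⟩

/-- For `N² = 0`: `(1 + N)(1 − N) = 1`. [folklore] -/
theorem one_add_mul_one_sub_of_mul_self_eq_zero {N : Matrix (Fin 2) (Fin 2) k} (hN : N * N = 0) :
    (1 + N) * (1 - N) = 1 := by
  rw [add_mul, mul_sub, mul_sub, one_mul, one_mul, mul_one, hN, sub_zero]
  abel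

/-- For `N² = 0`: `(1 − N)(1 + N) = 1`. [folklore] -/
theorem one_sub_mul_one_add_of_mul_self_eq_zero {N : Matrix (Fin 2) (Fin 2) k} (hN : N * N = 0) :
    (1 - N) * (1 + N) = 1 := by
  rw [sub_mul, mul_add, mul_add, one_mul, one_mul, mul_one, hN, add_zero]
  abel

/-- **The cocycle sum over `⟨u⟩`, `u = 1 + N`, `N² = 0`, in characteristic `3`:**
`x + u x u⁻¹ + u² x u⁻² = N x N` (with `u⁻¹ = 1 − N`, `u² = 1 + 2N`, `u⁻² = 1 − 2N`). [folklore] -/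
theorem conj_sum_eq_of_mul_self_eq_zero [CharP k 3] {N : Matrix (Fin 2) (Fin 2) k} (hN : N * N = 0) (x : Matrix (Fin 2) (Fin 2) k) :
    x + (1 + N) * x * (1 - N) + ((1 + N) * (1 + N)) * x * ((1 - N) * (1 - N)) = N * x * N := by
  have h3 : (3 : Matrix (Fin 2) (Fin 2) k) = 0 := by
    have h : ((3 : ℕ) : Matrix (Fin 2) (Fin 2) k) = 0 := CharP.cast_eq_zero (Matrix (Fin 2) (Fin 2) k) 3
    exact_mod_cast h
  -- expand; every `N N` vanishes
  have e1 : (1 + N) * x * (1 - N) = x + N * x - x * N - N * x * N := by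
    noncomm_ring
  have e2 : (1 + N) * (1 + N) = 1 + 2 • N := by
    rw [show (1 + N) * (1 + N) = 1 + 2 • N + N * N by noncomm_ring, hN, add_zero]
  have e3 : (1 - N) * (1 - N) = 1 - 2 • N := by
    rw [show (1 - N) * (1 - N) = 1 - 2 • N + N * N by noncomm_ring, hN, add_zero]
  have e4 : (1 + 2 • N) * x * (1 - 2 • N) = x + 2 • (N * x) - 2 • (x * N) - 4 • (N * x * N) := by
    noncomm_ring
  rw [e1, e2, e3, e4]
  -- collect: `3 x + 3 N x − 3 x N − 5 N x N = N x N` as `3 = 0`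
  have key : x + (x + N * x - x * N - N * x * N) +
      (x + 2 • (N * x) - 2 • (x * N) - 4 • (N * x * N)) - N * x * N =
      (3 : Matrix (Fin 2) (Fin 2) k) * (x + N * x - x * N - 2 • (N * x * N)) := by
    noncomm_ring
  rw [← sub_eq_zero, key, h3, zero_mul]

/-- **`𝔰𝔩₂` is `⟨u⟩`-cohomologically trivial in the frame `N = E₀₁`**: a trace-zero `x` with
`E₀₁ x E₀₁ = 0` (i.e. `x₁₀ = 0`) is `(1 + E₀₁) m (1 − E₀₁) − m` for a trace-zero `m`. [folklore] -/
theorem exists_eq_conj_sub_std [CharP k 3] (x : Matrix (Fin 2) (Fin 2) k) (hx : x.trace = 0)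
    (hNxN : !![(0 : k), 1; 0, 0] * x * !![(0 : k), 1; 0, 0] = 0) :
    ∃ m : Matrix (Fin 2) (Fin 2) k, m.trace = 0 ∧
      x = (1 + !![(0 : k), 1; 0, 0]) * m * (1 - !![(0 : k), 1; 0, 0]) - m := by
  have h3 : (3 : k) = 0 := by
    have h : ((3 : ℕ) : k) = 0 := CharP.cast_eq_zero k 3
    exact_mod_cast h
  have hx10 : x 1 0 = 0 := by
    have e := congr_fun (congr_fun hNxN 0) 1
    simp only [Matrix.mul_apply, Fin.sum_univ_two, Matrix.zero_apply] at e
    simpa using e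
  have hx11 : x 1 1 = -x 0 0 := by
    rw [Matrix.trace_fin_two] at hx
    linear_combination hx
  set E : Matrix (Fin 2) (Fin 2) k := !![(0 : k), 1; 0, 0] with hE
  set m : Matrix (Fin 2) (Fin 2) k := !![x 0 0 + x 0 1, 0; x 0 0, -(x 0 0 + x 0 1)] with hm
  refine ⟨m, ?_, ?_⟩
  · rw [hm, Matrix.trace_fin_two]
    simp
  -- `(1 + E) m (1 - E) - m = (a, -3a - 2b; 0, -a)` over any ring
  have hR : (1 + E) * m * (1 - E) - m = !![x 0 0, -3 * x 0 0 - 2 * x 0 1; 0, -x 0 0] := by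
    rw [hE, hm, Matrix.one_fin_two]
    ext i j
    fin_cases i <;> fin_cases j <;> simp
    ring
  rw [hR]
  -- and `-3a - 2b = b` in characteristic `3`
  have h01 : x 0 1 = -3 * x 0 0 - 2 * x 0 1 := by
    linear_combination (x 0 0 + x 0 1) * h3
  rw [← h01, ← hx10, ← hx11]
  exact Matrix.eta_fin_two x

/-- A non-zero square-zero `2 × 2` matrix is conjugate to `E₀₁`: `N P = P E₀₁` for an invertible
`P` (columns `N w`, `w` with `N w ≠ 0`). [folklore] -/
theorem exists_conj_eq_std_of_mul_self_eq_zero {N : Matrix (Fin 2) (Fin 2) k} (hN : N * N = 0) (hN0 : N ≠ 0) :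
    ∃ P : GL (Fin 2) k, N * (P : Matrix (Fin 2) (Fin 2) k) = (P : Matrix (Fin 2) (Fin 2) k) * !![(0 : k), 1; 0, 0] := by
  -- a vector not killed by `N`
  obtain ⟨w, hw⟩ : ∃ w : Fin 2 → k, N *ᵥ w ≠ 0 := by
    by_contra hall
    push Not at hall
    apply hN0
    ext i j
    have h := congr_fun (hall (Pi.single j 1)) i
    simpa [Matrix.mulVec, dotProduct, Pi.single_apply, Fin.sum_univ_two] using h
  set v : Fin 2 → k := N *ᵥ w with hv
  have hNv : N *ᵥ v = 0 := by rw [hv, Matrix.mulVec_mulVec, hN, Matrix.zero_mulVec]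
  -- `v, w` are independent
  have hdet : v 0 * w 1 - v 1 * w 0 ≠ 0 := by
    intro h0
    -- `w = a v` would give `N w = a N v = 0`
    by_cases h00 : v 0 = 0
    · have h1 : v 1 ≠ 0 := by
        intro h1; apply hw; ext i; fin_cases i <;> simp [hv] at h00 h1 ⊢ <;> assumption
      have hw0 : w 0 = 0 := by
        rw [h00, zero_mul, zero_sub, neg_eq_zero] at h0
        rcases mul_eq_zero.1 h0 with h' | h'
        · exact absurd h' h1
        · exact h'
      have hwv : w = (w 1 / v 1) • v := by
        ext i; fin_cases i
        · simp [h00, hw0]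
        · simp [div_mul_cancel₀ _ h1]
      apply hw
      rw [hv, hwv, Matrix.mulVec_smul, hNv, smul_zero]
    · have hwv : w = (w 0 / v 0) • v := by
        have e1 : w 1 = w 0 / v 0 * v 1 := by
          field_simp
          linear_combination h0
        ext i; fin_cases i
        · simp [div_mul_cancel₀ _ h00]
        · simpa using e1
      apply hw
      rw [hv, hwv, Matrix.mulVec_smul, hNv, smul_zero]
  set P : Matrix (Fin 2) (Fin 2) k := !![v 0, w 0; v 1, w 1] with hP
  have hPdet : P.det ≠ 0 := by
    rw [hP, Matrix.det_fin_two_of]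
    intro h0; apply hdet; linear_combination h0
  refine ⟨Matrix.GeneralLinearGroup.mkOfDetNeZero P hPdet, ?_⟩
  rw [Matrix.GeneralLinearGroup.val_mkOfDetNeZero]
  -- columns: `N v = 0`, `N w = v`
  have hv0 := congr_fun hNv 0
  have hv1 := congr_fun hNv 1
  have hw0' : (N *ᵥ w) 0 = v 0 := by rw [hv]
  have hw1' : (N *ᵥ w) 1 = v 1 := by rw [hv]
  simp only [Matrix.mulVec, dotProduct, Fin.sum_univ_two, Pi.zero_apply] at hv0 hv1 hw0' hw1'
  ext i j
  fin_cases i <;> fin_cases j <;>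
    simp [hP, Matrix.mul_apply, Fin.sum_univ_two, hv0, hv1, hw0', hw1']

/-- **`H¹(⟨u⟩, 𝔰𝔩₂) = 0` for `u = 1 + N`, `N ≠ 0`, `N² = 0`, `char k = 3`**, in equation form: a
trace-zero `x` with `N x N = 0` is `u m u⁻¹ − m` for some trace-zero `m` (transport of
`exists_eq_conj_sub_std` along `exists_conj_eq_std_of_mul_self_eq_zero`). [folklore] -/
theorem exists_eq_conj_sub_of_mul_self_eq_zero [CharP k 3] {N : Matrix (Fin 2) (Fin 2) k} (hN : N * N = 0)
    (hN0 : N ≠ 0) (x : Matrix (Fin 2) (Fin 2) k) (hx : x.trace = 0) (hNxN : N * x * N = 0) :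
    ∃ m : Matrix (Fin 2) (Fin 2) k, m.trace = 0 ∧ x = (1 + N) * m * (1 - N) - m := by
  obtain ⟨P, hP⟩ := exists_conj_eq_std_of_mul_self_eq_zero hN hN0
  set E : Matrix (Fin 2) (Fin 2) k := !![(0 : k), 1; 0, 0] with hE
  set Pm : Matrix (Fin 2) (Fin 2) k := (P : Matrix (Fin 2) (Fin 2) k) with hPm
  set Pi : Matrix (Fin 2) (Fin 2) k := ((P⁻¹ : GL (Fin 2) k) : Matrix (Fin 2) (Fin 2) k) with hPi
  have hPiP : Pi * Pm = 1 := by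
    rw [hPi, hPm, ← Units.val_mul, inv_mul_cancel, Units.val_one]
  have hPPi : Pm * Pi = 1 := by
    rw [hPi, hPm, ← Units.val_mul, mul_inv_cancel, Units.val_one]
  have hPiP' : ∀ X : Matrix (Fin 2) (Fin 2) k, Pi * (Pm * X) = X := fun X => by
    rw [← Matrix.mul_assoc, hPiP, Matrix.one_mul]
  have hPPi' : ∀ X : Matrix (Fin 2) (Fin 2) k, Pm * (Pi * X) = X := fun X => by
    rw [← Matrix.mul_assoc, hPPi, Matrix.one_mul]
  -- `E = P⁻¹ N P`, `N = P E P⁻¹`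
  have hE' : E = Pi * N * Pm := by
    rw [Matrix.mul_assoc, hP, ← Matrix.mul_assoc, hPiP, Matrix.one_mul]
  have hNE : N = Pm * E * Pi := by
    rw [hE']
    simp only [Matrix.mul_assoc, hPPi']
    rw [hPPi, Matrix.mul_one]
  -- the conjugated matrix
  set x' : Matrix (Fin 2) (Fin 2) k := Pi * x * Pm with hx'
  have hx't : x'.trace = 0 := by
    rw [hx', Matrix.trace_mul_cycle, hPPi, Matrix.one_mul, hx]
  have hEx'E : E * x' * E = 0 := by
    have e : E * x' * E = Pi * (N * x * N) * Pm := by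
      rw [hE', hx']
      simp only [Matrix.mul_assoc, hPPi']
    rw [e, hNxN, Matrix.mul_zero, Matrix.zero_mul]
  obtain ⟨m', hm't, hm'⟩ := exists_eq_conj_sub_std x' hx't hEx'E
  refine ⟨Pm * m' * Pi, ?_, ?_⟩
  · rw [Matrix.trace_mul_cycle, hPiP, Matrix.one_mul, hm't]
  -- transport back: `x = P x' P⁻¹`
  have hxx' : x = Pm * x' * Pi := by
    rw [hx']
    simp only [Matrix.mul_assoc, hPPi']
    rw [hPPi, Matrix.mul_one]
  have h1N : 1 + N = Pm * (1 + E) * Pi := by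
    rw [Matrix.mul_add, Matrix.add_mul, Matrix.mul_one, hPPi, hNE]
  have h1N' : 1 - N = Pm * (1 - E) * Pi := by
    rw [Matrix.mul_sub, Matrix.sub_mul, Matrix.mul_one, hPPi, hNE]
  rw [← hE] at hm'
  rw [hxx', hm', h1N, h1N']
  simp only [Matrix.mul_sub, Matrix.sub_mul, Matrix.mul_assoc, hPiP']

/-! ### The cohomological clause -/

/-- **`H¹(G, ad⁰) = 0` for a finite `G ≤ GL₂(k)`, `char k = 3`, whose Sylow `3`-subgroups have
order `3`** (`9 ∤ |G|` and `G` contains an element `u` of order `3`): the cocycle identity gives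
`f(u) + u f(u) u⁻¹ + u² f(u) u⁻² = f(u³) = 0`, i.e. `N f(u) N = 0` for `u = 1 + N`, so `f` is a
coboundary on `⟨u⟩` (`exists_eq_conj_sub_of_mul_self_eq_zero`), and `[G : ⟨u⟩]` is prime to `3`,
so `f` is a coboundary (tree `MonomialAdequacy.exists_eq_sub_of_subgroup`).  This is the
mechanism of Barnet-Lamb–Gee–Geraghty 2013, App. A, proof of Prop. A.2.1, Points 3–4 (`S₄`- and
`A₅`-type images at `ℓ = 3`). [folklore] -/
theorem adZeroRep_cocycles₁_le_coboundaries₁_of_card [CharP k 3] (G : Subgroup (GL (Fin 2) k))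
    [Finite G] (h9 : ¬ 9 ∣ Nat.card G) {u : GL (Fin 2) k} (huG : u ∈ G) (hu : orderOf u = 3) :
    groupCohomology.cocycles₁ (Rep.of (Subgroup.adZeroRep G)) ≤
      groupCohomology.coboundaries₁ (Rep.of (Subgroup.adZeroRep G)) := by
  classical
  haveI : Fact (Nat.Prime 3) := ⟨Nat.prime_three⟩
  rw [cocycles₁_le_coboundaries₁_iff_forall]
  intro f hf
  -- the cyclic subgroup `K = ⟨u⟩ ≤ G` and its index
  set uG : G := ⟨u, huG⟩ with huGdef
  have huG3 : orderOf uG = 3 := by rw [← Subgroup.orderOf_coe uG]; exact hu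
  set K : Subgroup G := Subgroup.zpowers uG with hK
  have hKcard : Nat.card K = 3 := by rw [hK, Nat.card_zpowers, huG3]
  haveI : K.FiniteIndex := inferInstance
  have hindex : (K.index : k) ≠ 0 := by
    intro h0
    have hdvd : 3 ∣ K.index := (CharP.cast_eq_zero_iff k 3 _).1 h0
    apply h9
    have hmul := Subgroup.card_eq_card_quotient_mul_card_subgroup K
    rw [← Subgroup.index_eq_card] at hmul
    rw [hmul, hKcard]
    exact Nat.mul_dvd_mul hdvd (dvd_refl 3)
  refine MonomialAdequacy.exists_eq_sub_of_subgroup _ K hindex f hf ?_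
  -- `u = 1 + N`, `N² = 0`, `N ≠ 0`
  set N : Matrix (Fin 2) (Fin 2) k := (u : Matrix (Fin 2) (Fin 2) k) - 1 with hN
  have hu3 : (u : Matrix (Fin 2) (Fin 2) k) ^ 3 = 1 := by
    rw [← Units.val_pow_eq_pow_val, ← hu, pow_orderOf_eq_one, Units.val_one]
  have hNN : N * N = 0 := sub_one_mul_self_eq_zero_of_pow_three hu3
  have hN0 : N ≠ 0 := by
    intro h0
    have hu1 : u = 1 := by
      apply Units.ext
      have : (u : Matrix (Fin 2) (Fin 2) k) = 1 := by rw [← sub_eq_zero]; exact h0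
      rw [this, Units.val_one]
    rw [hu1, orderOf_one] at hu
    exact absurd hu (by norm_num)
  have huN : (u : Matrix (Fin 2) (Fin 2) k) = 1 + N := by rw [hN]; abel
  have huinv : ((u⁻¹ : GL (Fin 2) k) : Matrix (Fin 2) (Fin 2) k) = 1 - N := by
    have h1 : (u : Matrix (Fin 2) (Fin 2) k) * (1 - N) = 1 := by rw [huN]; exact one_add_mul_one_sub_of_mul_self_eq_zero hNN
    calc ((u⁻¹ : GL (Fin 2) k) : Matrix (Fin 2) (Fin 2) k) = ((u⁻¹ : GL (Fin 2) k) : Matrix (Fin 2) (Fin 2) k) * ((u : Matrix (Fin 2) (Fin 2) k) * (1 - N)) := by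
          rw [h1, Matrix.mul_one]
      _ = 1 - N := by rw [← Matrix.mul_assoc, ← Units.val_mul, inv_mul_cancel, Units.val_one,
          Matrix.one_mul]
  -- the cocycle sum: `f(u) + u•f(u) + u²•f(u) = f(u³) = 0`
  set x : Matrix (Fin 2) (Fin 2) k := ((f uG : (adZero (Fin 2) k).toSubmodule) : Matrix (Fin 2) (Fin 2) k) with hx
  have hxt : x.trace = 0 := (mem_adZero_toSubmodule_iff _).1 (f uG).2
  have hsum : x + (1 + N) * x * (1 - N) + ((1 + N) * (1 + N)) * x * ((1 - N) * (1 - N)) = 0 := by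
    have hu3G : uG ^ 3 = 1 := by rw [← huG3]; exact pow_orderOf_eq_one uG
    have h := MonomialAdequacy.cocycle_apply_pow (Subgroup.adZeroRep G) f hf uG 3
    rw [hu3G, MonomialAdequacy.cocycle_apply_one _ f hf, Finset.sum_range_succ,
      Finset.sum_range_succ, Finset.sum_range_succ, Finset.sum_range_zero, zero_add, pow_zero,
      pow_one, map_one, Module.End.one_apply] at h
    have h' := congrArg Subtype.val h
    rw [ZeroMemClass.coe_zero, Submodule.coe_add, Submodule.coe_add, Subgroup.coe_adZeroRep_apply,
      Subgroup.coe_adZeroRep_apply] at h'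
    -- the group elements as matrices
    have hcoe : ((uG : G) : GL (Fin 2) k) = u := rfl
    have c1 : (((uG : G) : GL (Fin 2) k) : Matrix (Fin 2) (Fin 2) k) = 1 + N := by rw [hcoe, huN]
    have c1' : (((((uG : G) : GL (Fin 2) k))⁻¹ : GL (Fin 2) k) : Matrix (Fin 2) (Fin 2) k) = 1 - N := by
      rw [hcoe, huinv]
    have c2 : (((uG ^ 2 : G) : GL (Fin 2) k) : Matrix (Fin 2) (Fin 2) k) = (1 + N) * (1 + N) := by
      rw [Subgroup.coe_pow, hcoe, Units.val_pow_eq_pow_val, pow_two, huN]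
    have c2' : (((((uG ^ 2 : G) : GL (Fin 2) k))⁻¹ : GL (Fin 2) k) : Matrix (Fin 2) (Fin 2) k) = (1 - N) * (1 - N) := by
      rw [Subgroup.coe_pow, hcoe, ← inv_pow, Units.val_pow_eq_pow_val, pow_two, huinv]
    rw [c1, c1', c2, c2', ← hx] at h'
    rw [h']
  rw [conj_sum_eq_of_mul_self_eq_zero hNN] at hsum
  obtain ⟨m, hmt, hm⟩ := exists_eq_conj_sub_of_mul_self_eq_zero hNN hN0 x hxt hsum
  have hmem : m ∈ (adZero (Fin 2) k).toSubmodule := (mem_adZero_toSubmodule_iff _).2 hmt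
  refine ⟨⟨m, hmem⟩, ?_⟩
  -- on `K = ⟨u⟩` it suffices to check the generator
  have hgen : f uG = Subgroup.adZeroRep G uG ⟨m, hmem⟩ - ⟨m, hmem⟩ := by
    apply Subtype.ext
    rw [Submodule.coe_sub, Subgroup.coe_adZeroRep_apply, ← hx, hm, huGdef, huN, huinv]
  intro y hy
  rw [hK, Subgroup.mem_zpowers_iff] at hy
  obtain ⟨j, rfl⟩ := hy
  -- reduce to natural powers (finite order)
  obtain ⟨n, hn⟩ : ∃ n : ℕ, uG ^ j = uG ^ n := by
    refine ⟨(j % (orderOf uG : ℤ)).toNat, ?_⟩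
    rw [← zpow_natCast, Int.toNat_of_nonneg (Int.emod_nonneg _ (by rw [huG3]; norm_num)),
      zpow_mod_orderOf]
  rw [hn]
  exact MonomialAdequacy.cocycle_apply_pow_of_eq_sub _ f hf uG ⟨m, hmem⟩ hgen n

end Summit.Langlands.Langlands.Theorems.CoreAdequacy.NoAdequateLayer
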